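import Mathlib

/-!
# Crux `UniformPhotonSphereChannelsR` (K1R, stmt-FinalStateConjecture-14074), line
# `crum-peeling-recessive-tower` — stub `stub_rungZeroMajorant`: the `ℓ`-uniform rung-`0` majorant

The registered stub `stub_rungZeroMajorant` of the line's skeleton (continuation lead c2): the seed
rung of the uniform majorant induction along the recessive Riccati–Crum chain of the Regge–Wheeler
potential `V_{s,ℓ}`.  With `ω₀(w) = Σ_n Ω 0 n wⁿ` the normalised recessive Riccati variable of rung
`0`, the chain equation reads, coefficientwise,
`ℓ² Σ_{i ≤ n} Ω 0 i · Ω 0 (n−i) + ℓ ((n+1) Ω 0 n − 2n Ω 0 (n−1)) = rhs n` with `rhs 0 = ℓ(ℓ+1)`,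
`rhs 1 = 2(1−s²) − 2ℓ(ℓ+1)`, `rhs 2 = −4(1−s²)`, `rhs n = 0` (`n ≥ 3`), and `g₀ = 1/ω₀` has the
coefficients `G 0 n` (inversion clause `Σ_{i ≤ n} G 0 i · Ω 0 (n−i) = [n = 0]`).  We prove
`G 0 1 = (2ℓ² − 2(1−s²)) / (2ℓ(ℓ+1)) = −Ω 0 1 ∈ [0, 7/6]` and `|G 0 n| ≤ 2 · 16384ⁿ⁻¹ / n²`
(`n ≥ 2`).  For the latter the clause is solved for the top coefficient: at order `n ≥ 2` the pivot
is `ℓ(2ℓ + n + 1)` (the convolution contains `Ω 0 n` twice) and the ratios `|rhs n|/pivot ≤ 12`,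
`2ℓn/pivot ≤ 2`, `ℓ²/pivot ≤ 1/2` are `ℓ`-free (`rungZeroMajorant_solved`,
`rungZeroMajorant_absorb`), so `|Ω 0 n|` is majorised by the Catalan-type profile
`maj n = 128ⁿ/(16 n²)`
(`rungZeroMajorant_omega_bound`) thanks to the classical convolution estimate
`Σ_{0<i<n} 1/(i²(n−i)²) ≤ 8/n²` (`rungZeroMajorant_conv_core`: `1/(i(n−i)) = (1/i + 1/(n−i))/n` and
`Σ 1/i² ≤ 2`); the inversion gives `|G 0 n| ≤ 2 maj n` (`rungZeroMajorant_inv_bound`), far below the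
registered bound (`rungZeroMajorant_final`).  Only Mathlib is used.
-/

-- `Summit.<S>.<S>` repeats a namespace component by design (D-0017); off here as in the lakefile.
set_option linter.dupNamespace false

noncomputable section

namespace Summit.FinalStateConjecture.FinalStateConjecture.Theorems.CrumPeelingRecessiveTower

/-! ### The majorant profile and the convolution estimate -/

-- The Catalan-type majorant profile `maj n = 128ⁿ / (16 n²)` enters the lemmas below as a function
-- `M : ℕ → ℝ` with the hypothesis `hM : ∀ n, M n = 128 ^ n / (16 * n ^ 2)` (no definition).

/-- Partial sums of `Σ_{j ≥ 0} 1/(j+1)²` stay below `2 − 1/(m+1) ≤ 2` (telescoping). -/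
theorem rungZeroMajorant_sum_inv_sq (m : ℕ) :
    ∑ j ∈ Finset.range (m + 1), 1 / ((j : ℝ) + 1) ^ 2 ≤ 2 - 1 / ((m : ℝ) + 1) := by
  induction m with
  | zero => norm_num
  | succ k ih =>
    have hc : ((k + 1 : ℕ) : ℝ) = (k : ℝ) + 1 := by push_cast; ring
    rw [Finset.sum_range_succ, hc]
    -- `1/(k+2)² ≤ 1/(k+1) − 1/(k+2)`
    have key : 1 / ((k : ℝ) + 1) - 1 / ((k : ℝ) + 1 + 1) - 1 / ((k : ℝ) + 1 + 1) ^ 2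
        = 1 / (((k : ℝ) + 1) * ((k : ℝ) + 1 + 1) ^ 2) := by
      field_simp
      ring
    have hpos : 0 ≤ 1 / (((k : ℝ) + 1) * ((k : ℝ) + 1 + 1) ^ 2) := by positivity
    linarith

/-- The elementary termwise estimate behind the convolution bound:
`1/(x² y²) ≤ (2/(x+y)²) (1/x² + 1/y²)` for `x, y > 0` (i.e. `(x+y)² ≤ 2x² + 2y²`). -/
theorem rungZeroMajorant_term (x y : ℝ) (hx : 0 < x) (hy : 0 < y) :
    1 / (x ^ 2 * y ^ 2) ≤ 2 / (x + y) ^ 2 * (1 / x ^ 2 + 1 / y ^ 2) := by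
  rw [← sub_nonneg]
  obtain ⟨hx', hy', hxy⟩ : x ≠ 0 ∧ y ≠ 0 ∧ x + y ≠ 0 := ⟨hx.ne', hy.ne', (add_pos hx hy).ne'⟩
  have key : 2 / (x + y) ^ 2 * (1 / x ^ 2 + 1 / y ^ 2) - 1 / (x ^ 2 * y ^ 2)
      = (x - y) ^ 2 / ((x + y) ^ 2 * x ^ 2 * y ^ 2) := by
    field_simp
    ring
  rw [key]
  positivity

/-- The classical convolution estimate `Σ_{0<i<n} 1/(i² (n−i)²) ≤ 8/n²`, written for `n = m + 2`
with `i = j + 1`, `j < m + 1`. -/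
theorem rungZeroMajorant_conv_core (m : ℕ) :
    ∑ j ∈ Finset.range (m + 1), 1 / (((j : ℝ) + 1) ^ 2 * ((m : ℝ) + 1 - j) ^ 2)
      ≤ 8 / ((m : ℝ) + 2) ^ 2 := by
  have hterm : ∀ j ∈ Finset.range (m + 1),
      1 / (((j : ℝ) + 1) ^ 2 * ((m : ℝ) + 1 - j) ^ 2)
        ≤ 2 / ((m : ℝ) + 2) ^ 2 * (1 / ((j : ℝ) + 1) ^ 2 + 1 / ((m : ℝ) + 1 - j) ^ 2) := by
    intro j hj
    rw [Finset.mem_range] at hj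
    have hj' : (j : ℝ) ≤ m := by exact_mod_cast Nat.lt_succ_iff.mp hj
    have h := rungZeroMajorant_term ((j : ℝ) + 1) ((m : ℝ) + 1 - j) (by positivity) (by linarith)
    have e : (j : ℝ) + 1 + ((m : ℝ) + 1 - j) = (m : ℝ) + 2 := by ring
    rw [e] at h
    exact h
  refine (Finset.sum_le_sum hterm).trans ?_
  rw [← Finset.mul_sum, Finset.sum_add_distrib]
  -- reflect the second sum onto the first
  have hrefl : ∑ j ∈ Finset.range (m + 1), 1 / ((m : ℝ) + 1 - j) ^ 2
      = ∑ j ∈ Finset.range (m + 1), 1 / ((j : ℝ) + 1) ^ 2 := by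
    rw [← Finset.sum_range_reflect (fun j => 1 / ((j : ℝ) + 1) ^ 2) (m + 1)]
    refine Finset.sum_congr rfl fun j hj => ?_
    rw [Finset.mem_range] at hj
    have e : m + 1 - 1 - j = m - j := by omega
    simp only [e]
    rw [Nat.cast_sub (by omega : j ≤ m)]
    ring
  rw [hrefl]
  have hS := rungZeroMajorant_sum_inv_sq m
  have h1 : 0 < 1 / ((m : ℝ) + 1) := by positivity
  calc _ ≤ 2 / ((m : ℝ) + 2) ^ 2 * (2 + 2) := by gcongr <;> linarith
    _ = 8 / ((m : ℝ) + 2) ^ 2 := by ring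

/-- The convolution estimate for the profile: `Σ_{0<i<n} maj i · maj (n−i) ≤ maj n / 2`
(`n = m + 1`; trivial for `m = 0`). -/
theorem rungZeroMajorant_maj_conv (M : ℕ → ℝ) (hM : ∀ n, M n = 128 ^ n / (16 * (n : ℝ) ^ 2))
    (m : ℕ) : ∑ j ∈ Finset.range m, M (j + 1) * M (m - j) ≤ M (m + 1) / 2 := by
  cases m with
  | zero => rw [Finset.sum_range_zero, hM]; positivity
  | succ m =>
    have hterm : ∀ j ∈ Finset.range (m + 1), M (j + 1) * M (m + 1 - j)
        = 128 ^ (m + 1 + 1) / 256 * (1 / (((j : ℝ) + 1) ^ 2 * ((m : ℝ) + 1 - j) ^ 2)) := by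
      intro j hj
      rw [Finset.mem_range] at hj
      simp only [hM]
      have hjm : (j : ℝ) ≤ m := by exact_mod_cast Nat.lt_succ_iff.mp hj
      have hx : (j : ℝ) + 1 ≠ 0 := by positivity
      have hy : (m : ℝ) + 1 - j ≠ 0 := by
        have : (0 : ℝ) < (m : ℝ) + 1 - j := by linarith
        exact this.ne'
      have hpow : (128 : ℝ) ^ (m + 1 + 1) = 128 ^ (j + 1) * 128 ^ (m + 1 - j) := by
        rw [← pow_add]
        congr 1
        omega
      rw [hpow, Nat.cast_sub (by omega : j ≤ m + 1)]
      push_cast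
      field_simp
      ring
    rw [Finset.sum_congr rfl hterm, ← Finset.mul_sum]
    calc _ ≤ (128 : ℝ) ^ (m + 1 + 1) / 256 * (8 / ((m : ℝ) + 2) ^ 2) :=
            mul_le_mul_of_nonneg_left (rungZeroMajorant_conv_core m) (by positivity)
      _ = M (m + 1 + 1) / 2 := by
            rw [hM]
            push_cast
            field_simp
            ring

/-- An elementary growth estimate: `12 (m+2)² ≤ 16 · 128^(m+1)`. -/
theorem rungZeroMajorant_aux_pow (m : ℕ) : (12 : ℝ) * ((m : ℝ) + 2) ^ 2 ≤ 16 * 128 ^ (m + 1) := by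
  induction m with
  | zero => norm_num
  | succ k ih =>
    have hk : (0 : ℝ) ≤ k := Nat.cast_nonneg k
    have hc : ((k + 1 : ℕ) : ℝ) = (k : ℝ) + 1 := by push_cast; ring
    rw [hc, pow_succ (128 : ℝ) (k + 1)]
    nlinarith [ih, sq_nonneg ((k : ℝ) + 2)]

/-- The profile absorbs the solved recursion: `12 + 8 maj (n−1) ≤ 3 maj n` (`n = m + 2`). -/
theorem rungZeroMajorant_maj_step (M : ℕ → ℝ) (hM : ∀ n, M n = 128 ^ n / (16 * (n : ℝ) ^ 2))
    (m : ℕ) : 12 + 8 * M (m + 1) ≤ 3 * M (m + 1 + 1) := by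
  simp only [hM]
  have hm : (0 : ℝ) ≤ m := Nat.cast_nonneg m
  have hpow := rungZeroMajorant_aux_pow m
  have hc1 : ((m + 1 : ℕ) : ℝ) = (m : ℝ) + 1 := by push_cast; ring
  have hc2 : ((m + 1 + 1 : ℕ) : ℝ) = (m : ℝ) + 2 := by push_cast; ring
  rw [hc1, hc2, pow_succ (128 : ℝ) (m + 1)]
  have hX : (0 : ℝ) ≤ 128 ^ (m + 1) := by positivity
  have hB : (0 : ℝ) < ((m : ℝ) + 2) ^ 2 := by positivity
  have i1 : 8 * ((128 : ℝ) ^ (m + 1) / (16 * ((m : ℝ) + 1) ^ 2))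
      ≤ 8 * 128 ^ (m + 1) / ((m : ℝ) + 2) ^ 2 := by
    rw [mul_div_assoc', div_le_div_iff₀ (by positivity) hB]
    have hsq : ((m : ℝ) + 2) ^ 2 ≤ 16 * ((m : ℝ) + 1) ^ 2 := by nlinarith
    nlinarith [mul_le_mul_of_nonneg_left hsq hX]
  have i2 : (12 : ℝ) ≤ 16 * 128 ^ (m + 1) / ((m : ℝ) + 2) ^ 2 := by
    rw [le_div_iff₀ hB]
    linarith
  have e2 : 3 * ((128 : ℝ) ^ (m + 1) * 128 / (16 * ((m : ℝ) + 2) ^ 2))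
      = 8 * 128 ^ (m + 1) / ((m : ℝ) + 2) ^ 2 + 16 * 128 ^ (m + 1) / ((m : ℝ) + 2) ^ 2 := by
    field_simp
    ring
  linarith

/-- The `ℓ`-free absorption step: if `12 + 8 M₁ ≤ 3 M₂` then, for `ℓ ≥ 1`, `m ≥ 0`,
`12 + 2ℓ(m+2) M₁ + ℓ² M₂ / 2 ≤ (2ℓ² + ℓ(m+3)) M₂` (the pivot times the profile dominates the
solved right-hand side). -/
theorem rungZeroMajorant_absorb (ℓ m M₁ M₂ : ℝ) (hℓ : 1 ≤ ℓ) (hm : 0 ≤ m) (h₁ : 0 ≤ M₁)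
    (h₂ : 0 ≤ M₂) (hG : 12 + 8 * M₁ ≤ 3 * M₂) :
    12 + 2 * ℓ * (m + 2) * M₁ + ℓ ^ 2 * (M₂ / 2) ≤ (2 * ℓ ^ 2 + ℓ * (m + 3)) * M₂ := by
  have hℓ0 : 0 ≤ ℓ := by linarith
  have key : ℓ * (m + 3) * (12 + 8 * M₁) ≤ ℓ * (m + 3) * (3 * M₂) :=
    mul_le_mul_of_nonneg_left hG (by positivity)
  nlinarith [mul_nonneg hℓ0 h₁, mul_nonneg (mul_nonneg hℓ0 hm) h₁, mul_nonneg (sq_nonneg ℓ) h₂,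
    mul_nonneg (sub_nonneg.mpr hℓ) hm, mul_nonneg hℓ0 h₂, mul_nonneg (mul_nonneg hℓ0 hm) h₂,
    mul_nonneg hℓ0 hm]

/-! ### The rung-`0` recursion -/

/-- Splitting the convolution at order `m + 2`: the top coefficient occurs twice. -/
theorem rungZeroMajorant_sum_split (f : ℕ → ℝ) (m : ℕ) :
    ∑ i ∈ Finset.range (m + 1 + 1 + 1), f i * f (m + 1 + 1 - i)
      = 2 * (f 0 * f (m + 1 + 1)) + ∑ j ∈ Finset.range (m + 1), f (j + 1) * f (m + 1 - j) := by
  rw [Finset.sum_range_succ', Finset.sum_range_succ]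
  have hC : ∑ j ∈ Finset.range (m + 1), f (j + 1) * f (m + 1 + 1 - (j + 1))
      = ∑ j ∈ Finset.range (m + 1), f (j + 1) * f (m + 1 - j) :=
    Finset.sum_congr rfl fun j _ => by rw [Nat.add_sub_add_right]
  rw [hC, Nat.sub_self, Nat.sub_zero]
  ring

/-- **The order-`1` coefficient.**  The clause at `n = 1` reads `2ℓ(ℓ+1) Ω 0 1 = 2(1−s²) − 2ℓ²`. -/
theorem rungZeroMajorant_omega_one (s ℓ : ℕ) (hl : 1 ≤ ℓ) (a : ℕ → ℝ) (ha0 : a 0 = 1)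
    (hrec : ∀ n, (ℓ : ℝ) ^ 2 * ∑ i ∈ Finset.range (n + 1), a i * a (n - i)
          + (ℓ : ℝ) * (((n : ℝ) + 1) * a n - 2 * (n : ℝ) * a (n - 1))
          = (if n = 0 then (ℓ : ℝ) * ((ℓ : ℝ) + 1)
             else if n = 1 then 2 * (1 - (s : ℝ) ^ 2) - 2 * ((ℓ : ℝ) * ((ℓ : ℝ) + 1))
             else if n = 2 then -(4 * (1 - (s : ℝ) ^ 2)) else 0)) :
    a 1 = (2 * (1 - (s : ℝ) ^ 2) - 2 * (ℓ : ℝ) ^ 2) / (2 * (ℓ : ℝ) * ((ℓ : ℝ) + 1)) := by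
  have hℓ : (1 : ℝ) ≤ ℓ := by exact_mod_cast hl
  have h := hrec 1
  simp [Finset.sum_range_succ, ha0] at h
  rw [eq_div_iff (by positivity)]
  linear_combination h

/-- **The inversion at order `1`:** `G 0 1 = −Ω 0 1`. -/
theorem rungZeroMajorant_inv_one (a b : ℕ → ℝ) (ha0 : a 0 = 1) (hb0 : b 0 = 1)
    (hinv : ∀ n, ∑ i ∈ Finset.range (n + 1), b i * a (n - i) = if n = 0 then 1 else 0) :
    b 1 = -a 1 := by
  have h := hinv 1
  simp [Finset.sum_range_succ, ha0, hb0] at h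
  linarith

/-- **The solved recursion** at order `n = m + 2 ≥ 2`: the top coefficient times the pivot
`ℓ(2ℓ + n + 1)` equals the (bounded) source plus the lower-order terms. -/
theorem rungZeroMajorant_solved (s ℓ : ℕ) (hs : s ≤ 2) (a : ℕ → ℝ) (ha0 : a 0 = 1)
    (hrec : ∀ n, (ℓ : ℝ) ^ 2 * ∑ i ∈ Finset.range (n + 1), a i * a (n - i)
          + (ℓ : ℝ) * (((n : ℝ) + 1) * a n - 2 * (n : ℝ) * a (n - 1))
          = (if n = 0 then (ℓ : ℝ) * ((ℓ : ℝ) + 1)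
             else if n = 1 then 2 * (1 - (s : ℝ) ^ 2) - 2 * ((ℓ : ℝ) * ((ℓ : ℝ) + 1))
             else if n = 2 then -(4 * (1 - (s : ℝ) ^ 2)) else 0)) (m : ℕ) :
    ∃ R : ℝ, |R| ≤ 12 ∧
      (2 * (ℓ : ℝ) ^ 2 + (ℓ : ℝ) * ((m : ℝ) + 3)) * a (m + 1 + 1)
        = R + 2 * (ℓ : ℝ) * ((m : ℝ) + 2) * a (m + 1)
          - (ℓ : ℝ) ^ 2 * ∑ j ∈ Finset.range (m + 1), a (j + 1) * a (m + 1 - j) := by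
  refine ⟨if m + 1 + 1 = 2 then -(4 * (1 - (s : ℝ) ^ 2)) else 0, ?_, ?_⟩
  · split_ifs
    · have hs' : (s : ℝ) ≤ 2 := by exact_mod_cast hs
      have hs0 : (0 : ℝ) ≤ s := Nat.cast_nonneg s
      rw [abs_le]
      constructor <;> nlinarith
    · simp
  · have h := hrec (m + 1 + 1)
    have hc : ((m + 1 + 1 : ℕ) : ℝ) = (m : ℝ) + 2 := by push_cast; ring
    rw [if_neg (by omega : ¬ (m + 1 + 1 = 0)), if_neg (by omega : ¬ (m + 1 + 1 = 1)),
      rungZeroMajorant_sum_split a m, Nat.add_sub_cancel, ha0, hc] at h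
    linear_combination h

/-- **The rung-`0` majorant:** every solution of the clause with `|Ω 0 1| ≤ 7/6` satisfies
`|Ω 0 n| ≤ maj n = 128ⁿ/(16 n²)` for `n ≥ 1`, uniformly in `ℓ ≥ 1`, `s ≤ 2` (strong induction on the
order; the ratios of the solved recursion are `ℓ`-free). -/
theorem rungZeroMajorant_omega_bound (s ℓ : ℕ) (hs : s ≤ 2) (hl : 1 ≤ ℓ) (a : ℕ → ℝ)
    (ha0 : a 0 = 1) (ha1 : |a 1| ≤ 7 / 6)
    (hrec : ∀ n, (ℓ : ℝ) ^ 2 * ∑ i ∈ Finset.range (n + 1), a i * a (n - i)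
          + (ℓ : ℝ) * (((n : ℝ) + 1) * a n - 2 * (n : ℝ) * a (n - 1))
          = (if n = 0 then (ℓ : ℝ) * ((ℓ : ℝ) + 1)
             else if n = 1 then 2 * (1 - (s : ℝ) ^ 2) - 2 * ((ℓ : ℝ) * ((ℓ : ℝ) + 1))
             else if n = 2 then -(4 * (1 - (s : ℝ) ^ 2)) else 0))
    (M : ℕ → ℝ) (hM : ∀ n, M n = 128 ^ n / (16 * (n : ℝ) ^ 2)) :
    ∀ n, 1 ≤ n → |a n| ≤ M n := by
  have hℓ : (1 : ℝ) ≤ ℓ := by exact_mod_cast hl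
  have hMnn : ∀ n, 0 ≤ M n := fun n => by rw [hM]; positivity
  intro n
  refine Nat.strong_induction_on n ?_
  intro n ih hn
  rcases Nat.lt_or_ge n 2 with h2 | h2
  · obtain rfl : n = 1 := by omega
    have h8 : M 1 = 8 := by rw [hM]; norm_num
    rw [h8]
    linarith
  · obtain ⟨m, rfl⟩ : ∃ m, n = m + 1 + 1 := ⟨n - 2, by omega⟩
    obtain ⟨R, hR, hkey⟩ := rungZeroMajorant_solved s ℓ hs a ha0 hrec m
    have hM1 : |a (m + 1)| ≤ M (m + 1) := ih (m + 1) (by omega) (by omega)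
    have hC : |∑ j ∈ Finset.range (m + 1), a (j + 1) * a (m + 1 - j)| ≤ M (m + 1 + 1) / 2 := by
      refine (Finset.abs_sum_le_sum_abs _ _).trans
        ((Finset.sum_le_sum fun j hj => ?_).trans (rungZeroMajorant_maj_conv M hM (m + 1)))
      rw [Finset.mem_range] at hj
      rw [abs_mul]
      exact mul_le_mul (ih (j + 1) (by omega) (by omega)) (ih (m + 1 - j) (by omega) (by omega))
        (abs_nonneg _) (hMnn _)
    have hG := rungZeroMajorant_maj_step M hM m
    have hm : (0 : ℝ) ≤ m := Nat.cast_nonneg m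
    have hD : 0 < 2 * (ℓ : ℝ) ^ 2 + (ℓ : ℝ) * ((m : ℝ) + 3) := by positivity
    -- the pivot times `|a (m+2)|` is bounded by the solved right-hand side
    have habs : (2 * (ℓ : ℝ) ^ 2 + (ℓ : ℝ) * ((m : ℝ) + 3)) * |a (m + 1 + 1)|
        ≤ 12 + 2 * (ℓ : ℝ) * ((m : ℝ) + 2) * M (m + 1) + (ℓ : ℝ) ^ 2 * (M (m + 1 + 1) / 2) := by
      rw [← abs_of_pos hD, ← abs_mul, hkey]
      refine (abs_sub _ _).trans ((add_le_add (abs_add_le _ _) le_rfl).trans ?_)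
      rw [abs_mul (2 * (ℓ : ℝ) * ((m : ℝ) + 2)), abs_mul ((ℓ : ℝ) ^ 2),
        abs_of_nonneg (by positivity : (0 : ℝ) ≤ 2 * (ℓ : ℝ) * ((m : ℝ) + 2)),
        abs_of_nonneg (by positivity : (0 : ℝ) ≤ (ℓ : ℝ) ^ 2)]
      gcongr
    have hfin := habs.trans
      (rungZeroMajorant_absorb (ℓ : ℝ) (m : ℝ) (M (m + 1)) (M (m + 1 + 1)) hℓ hm (hMnn _) (hMnn _)
        hG)
    exact le_of_mul_le_mul_left hfin hD

/-- **The inversion majorant:** if `|Ω 0 n| ≤ maj n` for `n ≥ 1`, then the coefficients of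
`g₀ = 1/ω₀` satisfy `|G 0 n| ≤ 2 maj n` for `n ≥ 1` (strong induction on the order, using
`G 0 n = −Ω 0 n − Σ_{0<i<n} G 0 i · Ω 0 (n−i)` and the convolution estimate). -/
theorem rungZeroMajorant_inv_bound (a b : ℕ → ℝ) (ha0 : a 0 = 1) (hb0 : b 0 = 1)
    (hinv : ∀ n, ∑ i ∈ Finset.range (n + 1), b i * a (n - i) = if n = 0 then 1 else 0)
    (M : ℕ → ℝ) (hM : ∀ n, M n = 128 ^ n / (16 * (n : ℝ) ^ 2))
    (ha : ∀ n, 1 ≤ n → |a n| ≤ M n) : ∀ n, 1 ≤ n → |b n| ≤ 2 * M n := by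
  have hMnn : ∀ n, 0 ≤ M n := fun n => by rw [hM]; positivity
  intro n
  refine Nat.strong_induction_on n ?_
  intro n ih hn
  obtain ⟨m, rfl⟩ : ∃ m, n = m + 1 := ⟨n - 1, by omega⟩
  -- the inversion identity at order `m + 1`
  have h := hinv (m + 1)
  rw [if_neg (by omega : ¬ (m + 1 = 0)), Finset.sum_range_succ, Finset.sum_range_succ'] at h
  simp only [Nat.add_sub_add_right, Nat.sub_self, Nat.sub_zero, ha0, hb0, one_mul, mul_one] at h
  have hbm : b (m + 1) = -(a (m + 1) + ∑ j ∈ Finset.range m, b (j + 1) * a (m - j)) := by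
    linarith
  have hsum : |∑ j ∈ Finset.range m, b (j + 1) * a (m - j)|
      ≤ ∑ j ∈ Finset.range m, 2 * (M (j + 1) * M (m - j)) := by
    refine (Finset.abs_sum_le_sum_abs _ _).trans (Finset.sum_le_sum fun j hj => ?_)
    rw [Finset.mem_range] at hj
    rw [abs_mul, ← mul_assoc]
    exact mul_le_mul (ih (j + 1) (by omega) (by omega)) (ha (m - j) (by omega)) (abs_nonneg _)
      (mul_nonneg zero_le_two (hMnn _))
  rw [← Finset.mul_sum] at hsum
  have hconv := rungZeroMajorant_maj_conv M hM m
  rw [hbm, abs_neg]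
  calc |a (m + 1) + ∑ j ∈ Finset.range m, b (j + 1) * a (m - j)|
        ≤ |a (m + 1)| + |∑ j ∈ Finset.range m, b (j + 1) * a (m - j)| := abs_add_le _ _
    _ ≤ M (m + 1) + M (m + 1) := add_le_add (ha _ (by omega)) (hsum.trans (by linarith))
    _ = 2 * M (m + 1) := by ring

/-- The profile is far below the registered bound: `2 maj n ≤ 2 · 16384ⁿ⁻¹ / n²` for `n ≥ 2`. -/
theorem rungZeroMajorant_final (M : ℕ → ℝ) (hM : ∀ n, M n = 128 ^ n / (16 * (n : ℝ) ^ 2)) (m : ℕ) :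
    2 * M (m + 1 + 1) ≤ 2 * (16384 : ℝ) ^ (m + 1 + 1 - 1) / ((m + 1 + 1 : ℕ) : ℝ) ^ 2 := by
  have hc : ((m + 1 + 1 : ℕ) : ℝ) = (m : ℝ) + 2 := by push_cast; ring
  rw [hM, Nat.add_sub_cancel, hc]
  have hD : (0 : ℝ) < ((m : ℝ) + 2) ^ 2 := by positivity
  have hpow : (128 : ℝ) ^ (m + 1 + 1) ≤ 16 * 16384 ^ (m + 1) := by
    rw [show (16384 : ℝ) = 128 * 128 by norm_num, mul_pow, pow_succ (128 : ℝ) (m + 1)]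
    have h1 : (128 : ℝ) ≤ 128 ^ (m + 1) := le_self_pow₀ (by norm_num) (by omega)
    have h2 : (0 : ℝ) ≤ 128 ^ (m + 1) := by positivity
    nlinarith
  rw [← mul_div_assoc, div_le_div_iff₀ (by positivity) hD]
  nlinarith [mul_le_mul_of_nonneg_right hpow hD.le]

/-! ### The registered stub -/

/-- **Stub `stub_rungZeroMajorant` (registered signature).**  The `ℓ`-uniform base case of the
majorant induction along the recessive Riccati–Crum chain: for `s ≤ 2`, `s ≤ ℓ`, `1 ≤ ℓ`, the
rung-`0` coefficient arrays (`Ω 0 ·` solving the seed clause, `G 0 ·` its series inverse) satisfy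
`G 0 1 = (2ℓ² − 2(1−s²))/(2ℓ(ℓ+1)) ∈ [0, 7/6]` and `|G 0 n| ≤ 2 · 16384ⁿ⁻¹ / n²` for `n ≥ 2`. -/
theorem stub_rungZeroMajorant :
    ∀ (s ℓ : ℕ), s ≤ 2 → s ≤ ℓ → 1 ≤ ℓ → ∀ (Ω G : ℕ → ℕ → ℝ),
      Ω 0 0 = 1 → G 0 0 = 1 →
      (∀ n, ∑ i ∈ Finset.range (n + 1), G 0 i * Ω 0 (n - i) = if n = 0 then 1 else 0) →
      (∀ n, (ℓ : ℝ) ^ 2 * ∑ i ∈ Finset.range (n + 1), Ω 0 i * Ω 0 (n - i)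
          + (ℓ : ℝ) * (((n : ℝ) + 1) * Ω 0 n - 2 * (n : ℝ) * Ω 0 (n - 1))
          = (if n = 0 then (ℓ : ℝ) * ((ℓ : ℝ) + 1)
             else if n = 1 then 2 * (1 - (s : ℝ) ^ 2) - 2 * ((ℓ : ℝ) * ((ℓ : ℝ) + 1))
             else if n = 2 then -(4 * (1 - (s : ℝ) ^ 2)) else 0)) →
      G 0 1 = (2 * (ℓ : ℝ) ^ 2 - 2 * (1 - (s : ℝ) ^ 2)) / (2 * (ℓ : ℝ) * ((ℓ : ℝ) + 1)) ∧
      0 ≤ G 0 1 ∧ G 0 1 ≤ 7 / 6 ∧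
      ∀ n, 2 ≤ n → |G 0 n| ≤ 2 * (16384 : ℝ) ^ (n - 1) / (n : ℝ) ^ 2 := by
  intro s ℓ hs hsl hl Ω G hΩ0 hG0 hinv hrec
  have hℓ : (1 : ℝ) ≤ ℓ := by exact_mod_cast hl
  have ha1 : Ω 0 1 = (2 * (1 - (s : ℝ) ^ 2) - 2 * (ℓ : ℝ) ^ 2) / (2 * (ℓ : ℝ) * ((ℓ : ℝ) + 1)) :=
    rungZeroMajorant_omega_one s ℓ hl (Ω 0) hΩ0 hrec
  have hb1 : G 0 1 = -Ω 0 1 := rungZeroMajorant_inv_one (Ω 0) (G 0) hΩ0 hG0 hinv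
  have hG1 : G 0 1 = (2 * (ℓ : ℝ) ^ 2 - 2 * (1 - (s : ℝ) ^ 2)) / (2 * (ℓ : ℝ) * ((ℓ : ℝ) + 1)) := by
    rw [hb1, ha1]
    ring
  have hG1nn : 0 ≤ G 0 1 := by
    rw [hG1]
    apply div_nonneg
    · nlinarith [sq_nonneg (s : ℝ)]
    · positivity
  have hG1le : G 0 1 ≤ 7 / 6 := by
    have hsl' : (s : ℝ) ≤ ℓ := by exact_mod_cast hsl
    rw [hG1, div_le_iff₀ (by positivity)]
    interval_cases s <;> push_cast at hsl' ⊢ <;> nlinarith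
  have habs1 : |Ω 0 1| ≤ 7 / 6 := by
    rw [show Ω 0 1 = -G 0 1 by rw [hb1]; ring, abs_neg, abs_of_nonneg hG1nn]
    exact hG1le
  -- the majorant profile `maj n = 128ⁿ / (16 n²)`
  obtain ⟨M, hM⟩ : ∃ M : ℕ → ℝ, ∀ n, M n = 128 ^ n / (16 * (n : ℝ) ^ 2) := ⟨_, fun n => rfl⟩
  have hA := rungZeroMajorant_omega_bound s ℓ hs hl (Ω 0) hΩ0 habs1 hrec M hM
  have hB := rungZeroMajorant_inv_bound (Ω 0) (G 0) hΩ0 hG0 hinv M hM hA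
  refine ⟨hG1, hG1nn, hG1le, fun n hn => ?_⟩
  obtain ⟨m, rfl⟩ : ∃ m, n = m + 1 + 1 := ⟨n - 2, by omega⟩
  exact (hB (m + 1 + 1) (by omega)).trans (rungZeroMajorant_final M hM m)

end Summit.FinalStateConjecture.FinalStateConjecture.Theorems.CrumPeelingRecessiveTower

end
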